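import Literature.MathematicalPhysics.QuantumFieldTheory.Balaban1983to89.B13CauchyDecay

/-!
# `Balaban1983to89.B13CauchyDecayPoly` — T. Bałaban, *Renormalization group approach to lattice gauge field theories. II.
Cluster expansions*, Commun. Math. Phys. **116** (1988) 1–22 [Balaban1988RG2Cluster], pp. 15–17: the (2.14) ⇒ (2.26)
Cauchy mechanism of `B13Term214` ∕ `B13CauchyDecay` with PER-DOMAIN regions of holomorphy in the τ-parameters

statement-level skeleton of published theorems with citation tags; proofs where landed; nothing here is a claim about
the Yang–Mills mass gap

WHY (cell `pub-balaban-gaps`, seat ne5 gen 6; cell records (x8), X-H4-1).  Print chooses the τ-radii PER DOMAIN: (2.18) p. 16,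
`|τ(Y)| = (E₀ε₁C₁α₄⁻¹M^q e^{C₂κ₁})⁻¹ exp((1 − 3δ)κd_k(Y))`, GROWING with `d_k(Y)`; the gain of (2.26) is `Π_{Y∈𝐃} 2/|τ(Y)|`.  The
tree's regularity class `B13Term214.SepHolOn U Φ` has ONE open set `U` for every coordinate: used for the τ (hypothesis `hΨτ`
of `B13CauchyDecay.norm_term214_le` … `B13Bound226Located.norm_term214_le_226_of_primitives`) it asks holomorphy — hence, for
the block model's last line, the domination (2.20) — on the cube `U^𝐃` with `U ⊇` the LARGEST disc, which is uniform in the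
torus only if (2.20) held at the uniform radius `max_Y |τ(Y)|`.  This file supplies the per-coordinate class and re-runs the
mechanism for it; the σ-parameters keep the single open set (print: all σ-radii equal `e^{κ₁}`, p. 16).

CONTENT (generic finite-dimensional complex analysis; values in a complex normed space `E`):
* `SepHolOnPoly (U : ι → Set ℂ) Φ` — `Φ` is holomorphic in the coordinate `i` on `U i` at every base point `p` with
  `p j ∈ U j` for all `j`; `sepHolOnPoly_const_iff` (constant family = the tree's `SepHolOn`), `SepHolOnPoly.mono`,
  `sepHolOnPoly_of_differentiableOn` (joint ⇒ separate).
* `TopC_eq_DopC_poly` — the Cauchy form (2.14) equals the difference form (2.8)/(2.1) (`B13Term214.TopC_eq_DopC`, poly).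
* `norm_DopC_le_poly` — `‖DopC S Φ p‖ ≤ K · Π_{i∈S} (R_i − 1)⁻¹` with `{|z| ≤ R_i} ⊆ U i` (`B13CauchyDecay.norm_DopC_le`, poly).
* `sepHolOn_DopC_inner_poly`, `term214_eq_DopC_polyτ`, `norm_term214_le_polyτ` — the two-family term (2.14) with the σ on one
  open `Uσ` and the τ on `Uτ : κ → Set ℂ` (`B13Term214.term214_eq_DopC`, `B13CauchyDecay.norm_term214_le`, poly in τ).
* `norm_term214_le_215_polyτ` — (2.15)'s Cauchy part at σ-radius `e^{κ₁}` and arbitrary τ-radii `R_τ(Y) ≥ 2` with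
  `{|z| ≤ R_τ(Y)} ⊆ Uτ Y`: `‖(2.14)‖ ≤ exp(−(κ₁ − 1)|lZ|)·[Π_Y 2/R_τ(Y)]·K` (`B13CauchyDecay.norm_term214_le_215`, poly in τ).

HONEST SCOPE.  Hypothesis shapes and elementary complex analysis; the analyticity of the paper's functions and their sup
bounds remain HYPOTHESES here (derived for the block model's (2.14) in `B13Core214Holomorphic*`); nothing of Bałaban's is
constructed; (D4) 0∕1, spine 0∕9 UNCHANGED; NOT continuum, NOT mass gap, NOT Clay.  0 sorry; one definition (`SepHolOnPoly`,
a regularity class, no named fact).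
-/

noncomputable section

namespace Literature.MathematicalPhysics.QuantumFieldTheory.Balaban1983to89.B13CauchyDecayPoly

open Complex Metric Set Finset
open Literature.MathematicalPhysics.QuantumFieldTheory.Balaban1983to89
open Literature.MathematicalPhysics.QuantumFieldTheory.Balaban1983to89.B13Term214
open Literature.MathematicalPhysics.QuantumFieldTheory.Balaban1983to89.B13CauchyDecay
  (norm_sub_one_zero_le norm_TopC_le closedBall_subset_closedBall_of_mem_uIcc inv_sub_one_le_two_mul_inv
    pow_inv_exp_sub_one_le)

/-! ## §A. The per-coordinate regularity class -/

section Poly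

variable {E : Type*} [NormedAddCommGroup E] [NormedSpace ℂ E]
variable {ι : Type*} [DecidableEq ι]

/-- **Separate holomorphy with PER-COORDINATE regions** (p. 15 *"analytic function … of the complex parameters σ(Z), τ"*
with the per-domain radii (2.18) p. 16): `Φ` is holomorphic in the coordinate `i` on the open set `U i`, at every base point
all of whose coordinates `j` lie in their `U j` (a DEFINITION of a regularity class; the tree's `B13Term214.SepHolOn U` is the
constant family, `sepHolOnPoly_const_iff`). [cite: Balaban1988RG2Cluster, (2.14) p.15, (2.18) p.16] -/
def SepHolOnPoly (U : ι → Set ℂ) (Φ : (ι → ℂ) → E) : Prop :=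
  ∀ (i : ι) (p : ι → ℂ), (∀ j, p j ∈ U j) → DifferentiableOn ℂ (fun z => Φ (Function.update p i z)) (U i)

/-- The constant family is the tree's class: `SepHolOnPoly (fun _ => U) Φ ↔ SepHolOn U Φ`.
[cite: Balaban1988RG2Cluster, (2.14) p.15] (elementary API for (2.14)) -/
theorem sepHolOnPoly_const_iff {U : Set ℂ} {Φ : (ι → ℂ) → E} : SepHolOnPoly (fun _ : ι => U) Φ ↔ SepHolOn U Φ :=
  Iff.rfl

/-- Restriction to smaller regions: `SepHolOnPoly U Φ → SepHolOnPoly V Φ` when `V i ⊆ U i` for all `i` (so a function of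
the tree's class on one big `U` is of the poly class on any family of subsets).
[cite: Balaban1988RG2Cluster, (2.14) p.15] (elementary API for (2.14)) -/
theorem SepHolOnPoly.mono {U V : ι → Set ℂ} {Φ : (ι → ℂ) → E} (hΦ : SepHolOnPoly U Φ) (hVU : ∀ i, V i ⊆ U i) :
    SepHolOnPoly V Φ :=
  fun i p hp => (hΦ i p fun j => hVU j (hp j)).mono (hVU i)

/-- Joint holomorphy implies the poly class: if `Φ` is complex-differentiable on a set `W` containing every parameter point
`q` with `q j ∈ U j` for all `j`, then `SepHolOnPoly U Φ` (composition with the affine line `z ↦ p|_{i:=z}`).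
[cite: Balaban1988RG2Cluster, (2.14) p.15] (elementary API for (2.14)) -/
theorem sepHolOnPoly_of_differentiableOn [Fintype ι] {U : ι → Set ℂ} {W : Set (ι → ℂ)}
    (hW : ∀ q : ι → ℂ, (∀ j, q j ∈ U j) → q ∈ W) {Φ : (ι → ℂ) → E} (hΦ : DifferentiableOn ℂ Φ W) :
    SepHolOnPoly U Φ := by
  intro i p hp
  have hmaps : Set.MapsTo (fun z : ℂ => Function.update p i z) (U i) W := by
    intro z hz
    refine hW _ fun j => ?_
    rcases eq_or_ne j i with rfl | hj
    · simp [hz]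
    · show Function.update p i z j ∈ U j
      rw [Function.update_of_ne hj]; exact hp j
  exact hΦ.comp (fun z _ => (hasDerivAt_update p i z).differentiableAt.differentiableWithinAt) hmaps

/-- Updating a coordinate outside `S` commutes with `cornerC S T` (plumbing; the statement of the private lemma of
`B13Term214` ∕ `B13CauchyDecay`). [cite: Balaban1988RG2Cluster, (2.14) p.15] (elementary API for (2.14)) -/
private theorem cornerC_update {S T : Finset ι} {i : ι} (hi : i ∉ S) (p : ι → ℂ) (a : ℂ) :
    cornerC S T (Function.update p i a) = Function.update (cornerC S T p) i a := by
  funext j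
  by_cases hj : j = i
  · subst hj; simp [cornerC, hi]
  · simp [cornerC, Function.update, hj]

/-- The coordinates of a corner over `S` lie in their regions when `0, 1 ∈ U j` for `j ∈ S` and the base point does
(plumbing). [cite: Balaban1988RG2Cluster, (2.14) p.15] (elementary API for (2.14)) -/
private theorem cornerC_mem_poly {U : ι → Set ℂ} (S T : Finset ι) (h0 : ∀ j ∈ S, (0 : ℂ) ∈ U j)
    (h1 : ∀ j ∈ S, (1 : ℂ) ∈ U j) {p : ι → ℂ} (hp : ∀ j, p j ∈ U j) (j : ι) : cornerC S T p j ∈ U j := by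
  unfold cornerC
  split_ifs with hjS hjT
  · exact h1 j hjS
  · exact h0 j hjS
  · exact hp j

/-- For `Φ` of the poly class, the iterated difference at the corners over `S` is holomorphic in a fresh parameter `i ∉ S`
on ITS region: `z ↦ DopC S Φ (p|_{i:=z})` is holomorphic on `U i` (finite sum of holomorphic functions; plumbing).
[cite: Balaban1988RG2Cluster, (2.14) p.15] (elementary API for (2.14)) -/
private theorem differentiableOn_DopC_update_poly {U : ι → Set ℂ} {S : Finset ι} (h0 : ∀ j ∈ S, (0 : ℂ) ∈ U j)
    (h1 : ∀ j ∈ S, (1 : ℂ) ∈ U j) {Φ : (ι → ℂ) → E} (hΦ : SepHolOnPoly U Φ) {i : ι} (hi : i ∉ S) {p : ι → ℂ}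
    (hp : ∀ j, p j ∈ U j) : DifferentiableOn ℂ (fun z => DopC S Φ (Function.update p i z)) (U i) := by
  have key : ∀ z, DopC S Φ (Function.update p i z)
      = ∑ T ∈ S.powerset, ((-1 : ℂ) ^ (S \ T).card) • Φ (Function.update (cornerC S T p) i z) := by
    intro z
    simp only [DopC]
    exact Finset.sum_congr rfl fun T _ => by rw [cornerC_update hi]
  simp_rw [key]
  refine DifferentiableOn.fun_sum fun T _ => ?_
  exact (hΦ i (cornerC S T p) (cornerC_mem_poly S T h0 h1 hp)).const_smul _

/-! ## §B. (2.14) = the difference form, and the iterated Cauchy estimate, with per-coordinate regions -/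

/-- **The Cauchy form of (2.14) equals the difference form of (2.8)/(2.1), per-coordinate regions**: for `Φ` of the poly
class on open `U i` each containing the closed `r`-discs about `[0, 1]`, and a list `l` of distinct parameters,
`(Π_{i∈l} ∫₀¹ds(i)(1/2πi)∮dσ(i)/(σ(i) − s(i))²) Φ (p) = Σ_{T⊆l} (−1)^{|l∖T|} Φ(corner l T p)` at every base point of the regions
(one `B13Term214.integral_cauchyD_eq_sub` per parameter, on `U i`; induction on `l`).
[cite: Balaban1988RG2Cluster, (2.14) p.15] -/
theorem TopC_eq_DopC_poly [CompleteSpace E] {U : ι → Set ℂ} (hU : ∀ i, IsOpen (U i)) {r : ℝ} (hr : 0 < r)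
    (hsub : ∀ i, ∀ s ∈ Set.uIcc (0 : ℝ) 1, closedBall (s : ℂ) r ⊆ U i) {Φ : (ι → ℂ) → E} (hΦ : SepHolOnPoly U Φ) :
    ∀ (l : List ι), l.Nodup → ∀ p : ι → ℂ, (∀ j, p j ∈ U j) → TopC r l Φ p = DopC l.toFinset Φ p := by
  have h0 : ∀ i, (0 : ℂ) ∈ U i := fun i => by
    simpa using hsub i 0 (by simp) (mem_closedBall_self hr.le)
  have h1 : ∀ i, (1 : ℂ) ∈ U i := fun i => by
    simpa using hsub i 1 (by simp) (mem_closedBall_self hr.le)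
  intro l
  induction l with
  | nil => intro _ p _; simp [TopC, DopC_empty]
  | cons i l ih =>
    intro hnd p hp
    obtain ⟨hi, hl⟩ := List.nodup_cons.1 hnd
    have hi' : i ∉ l.toFinset := by simpa using hi
    simp only [TopC, List.toFinset_cons]
    -- the integrand agrees, on `U i`, with the holomorphic finite sum `z ↦ DopC l Φ (p|_{i:=z})`
    have hmemz : ∀ z ∈ U i, ∀ j, Function.update p i z j ∈ U j := by
      intro z hz j
      rcases eq_or_ne j i with rfl | hj
      · simpa using hz
      · simpa [Function.update, hj] using hp j
    have hcongr : ∀ s ∈ Set.uIcc (0 : ℝ) 1,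
        cauchyD r (fun z => TopC r l Φ (Function.update p i z)) s
          = cauchyD r (fun z => DopC l.toFinset Φ (Function.update p i z)) s := by
      intro s hs
      simp only [cauchyD]
      congr 1
      refine circleIntegral.integral_congr hr.le fun z hz => ?_
      have hzU : z ∈ U i := hsub i s hs (sphere_subset_closedBall hz)
      rw [ih hl _ (hmemz z hzU)]
    rw [intervalIntegral.integral_congr hcongr,
      integral_cauchyD_eq_sub (hU i)
        (differentiableOn_DopC_update_poly (fun j _ => h0 j) (fun j _ => h1 j) hΦ hi' hp) hr (hsub i),
      DopC_insert hi']

/-- **The iterated Cauchy estimate for the decoupling differences, per-coordinate regions** (mechanism of (2.26) p. 17 at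
the per-domain radii (2.18)): `Φ` of the poly class on open `U i ⊇ {|z| ≤ R_i}`, `‖Φ q‖ ≤ K` on the closed polydisc
`{q : |q_j| ≤ R_j ∀ j}`; then for every finite `S` with `R_i > 1` on `S` and every base point `p` of the polydisc,
`‖DopC S Φ p‖ ≤ K · Π_{i∈S} (R_i − 1)⁻¹` (induction on `S`; `B13CauchyDecay.norm_sub_one_zero_le` on `U i`).
[cite: Balaban1988RG2Cluster, (2.26) p.17] -/
theorem norm_DopC_le_poly {U : ι → Set ℂ} (hU : ∀ i, IsOpen (U i)) {Φ : (ι → ℂ) → E} (hΦ : SepHolOnPoly U Φ)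
    {R : ι → ℝ} (hRU : ∀ j, closedBall (0 : ℂ) (R j) ⊆ U j) {K : ℝ}
    (hK : ∀ q : ι → ℂ, (∀ j, ‖q j‖ ≤ R j) → ‖Φ q‖ ≤ K) (S : Finset ι) (hR1 : ∀ i ∈ S, 1 < R i) :
    ∀ p : ι → ℂ, (∀ j, ‖p j‖ ≤ R j) → ‖DopC S Φ p‖ ≤ K * ∏ i ∈ S, (R i - 1)⁻¹ := by
  induction S using Finset.induction_on with
  | empty =>
    intro p hp
    simpa [DopC_empty] using hK p hp
  | @insert i S hi ih =>
    intro p hp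
    have hR1S : ∀ j ∈ S, 1 < R j := fun j hj => hR1 j (Finset.mem_insert_of_mem hj)
    have hRi : 1 < R i := hR1 i (Finset.mem_insert_self i S)
    have h0 : ∀ j ∈ S, (0 : ℂ) ∈ U j := fun j hj =>
      hRU j (by rw [mem_closedBall_zero_iff, norm_zero]; linarith [hR1S j hj])
    have h1 : ∀ j ∈ S, (1 : ℂ) ∈ U j := fun j hj =>
      hRU j (by rw [mem_closedBall_zero_iff, norm_one]; exact (hR1S j hj).le)
    have hpU : ∀ j, p j ∈ U j := fun j => hRU j (mem_closedBall_zero_iff.2 (hp j))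
    have hgd : DifferentiableOn ℂ (fun z => DopC S Φ (Function.update p i z)) (U i) :=
      differentiableOn_DopC_update_poly h0 h1 hΦ hi hpU
    have hgb : ∀ z : ℂ, ‖z‖ ≤ R i →
        ‖DopC S Φ (Function.update p i z)‖ ≤ K * ∏ j ∈ S, (R j - 1)⁻¹ := by
      intro z hz
      refine ih hR1S (Function.update p i z) fun j => ?_
      rcases eq_or_ne j i with rfl | hj
      · simpa using hz
      · rw [Function.update_of_ne hj]; exact hp j
    rw [DopC_insert hi, Finset.prod_insert hi]
    calc ‖DopC S Φ (Function.update p i 1) - DopC S Φ (Function.update p i 0)‖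
        ≤ (K * ∏ j ∈ S, (R j - 1)⁻¹) / (R i - 1) := norm_sub_one_zero_le (hU i) hgd hRi (hRU i) hgb
      _ = K * ((R i - 1)⁻¹ * ∏ j ∈ S, (R j - 1)⁻¹) := by rw [div_eq_mul_inv]; ring

/-- A finite alternating sum of functions separately holomorphic in `σ` is separately holomorphic in `σ`: the inner
iterated difference `σ ↦ DopC S (Ψ σ ·) τ₀` of the two-family term (2.14), the admissible `τ` being those of the
per-domain regions (plumbing for `norm_term214_le_polyτ`). [cite: Balaban1988RG2Cluster, (2.14) p.15] (elementary API for (2.14)) -/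
theorem sepHolOn_DopC_inner_poly {κ : Type*} [DecidableEq κ] {Uσ : Set ℂ} {Uτ : κ → Set ℂ}
    {Ψ : (ι → ℂ) → (κ → ℂ) → E} (hΨσ : ∀ τ : κ → ℂ, (∀ j, τ j ∈ Uτ j) → SepHolOn Uσ (fun σ => Ψ σ τ))
    (S : Finset κ) (h0 : ∀ j ∈ S, (0 : ℂ) ∈ Uτ j) (h1 : ∀ j ∈ S, (1 : ℂ) ∈ Uτ j)
    {τ₀ : κ → ℂ} (hτ₀ : ∀ j, τ₀ j ∈ Uτ j) :
    SepHolOn Uσ (fun σ => DopC S (fun τ => Ψ σ τ) τ₀) := by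
  intro i p hp
  have key : ∀ z, DopC S (fun τ => Ψ (Function.update p i z) τ) τ₀
      = ∑ T ∈ S.powerset, ((-1 : ℂ) ^ (S \ T).card) • Ψ (Function.update p i z) (cornerC S T τ₀) := fun z => rfl
  simp_rw [key]
  refine DifferentiableOn.fun_sum fun T _ => ?_
  exact (hΨσ (cornerC S T τ₀) (cornerC_mem_poly S T h0 h1 hτ₀) i p hp).const_smul _

/-- **(2.14) = the (2.8)×(2.1) difference form, per-domain τ-regions**: `Ψ(σ, τ)` separately holomorphic in the `σ` on one
open `Uσ` (for every τ of the regions) and of the poly class in the `τ` on open `Uτ Y` (for every σ of `Uσ`), all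
containing the closed `r`-discs about `[0, 1]`; then `term214 r lZ lD Ψ σ₀ τ₀ = D^σ_{lZ} D^τ_{lD} Ψ` at base points of the
regions (`B13Term214.term214_eq_DopC`, poly in τ). [cite: Balaban1988RG2Cluster, (2.14) p.15] -/
theorem term214_eq_DopC_polyτ [CompleteSpace E] {κ : Type*} [DecidableEq κ] {Uσ : Set ℂ} {Uτ : κ → Set ℂ}
    (hUσ : IsOpen Uσ) (hUτ : ∀ Y, IsOpen (Uτ Y)) {r : ℝ} (hr : 0 < r)
    (hsubσ : ∀ s ∈ Set.uIcc (0 : ℝ) 1, closedBall (s : ℂ) r ⊆ Uσ)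
    (hsubτ : ∀ Y, ∀ s ∈ Set.uIcc (0 : ℝ) 1, closedBall (s : ℂ) r ⊆ Uτ Y) {Ψ : (ι → ℂ) → (κ → ℂ) → E}
    (hΨσ : ∀ τ : κ → ℂ, (∀ j, τ j ∈ Uτ j) → SepHolOn Uσ (fun σ => Ψ σ τ))
    (hΨτ : ∀ σ : ι → ℂ, (∀ j, σ j ∈ Uσ) → SepHolOnPoly Uτ (fun τ => Ψ σ τ))
    {lZ : List ι} (hlZ : lZ.Nodup) {lD : List κ} (hlD : lD.Nodup) {σ₀ : ι → ℂ} (hσ₀ : ∀ j, σ₀ j ∈ Uσ)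
    {τ₀ : κ → ℂ} (hτ₀ : ∀ j, τ₀ j ∈ Uτ j) :
    term214 r lZ lD Ψ σ₀ τ₀ = DopC lZ.toFinset (fun σ => DopC lD.toFinset (fun τ => Ψ σ τ) τ₀) σ₀ := by
  have h0 : ∀ Y, (0 : ℂ) ∈ Uτ Y := fun Y => by
    simpa using hsubτ Y 0 (by simp) (mem_closedBall_self hr.le)
  have h1 : ∀ Y, (1 : ℂ) ∈ Uτ Y := fun Y => by
    simpa using hsubτ Y 1 (by simp) (mem_closedBall_self hr.le)
  unfold term214
  -- inner operator: Cauchy form = difference form at every admissible `σ`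
  have hinner : ∀ σ : ι → ℂ, (∀ j, σ j ∈ Uσ) →
      TopC r lD (fun τ => Ψ σ τ) τ₀ = DopC lD.toFinset (fun τ => Ψ σ τ) τ₀ :=
    fun σ hσ => TopC_eq_DopC_poly hUτ hr hsubτ (hΨτ σ hσ) lD hlD τ₀ hτ₀
  rw [TopC_congr hr hsubσ hinner lZ σ₀ hσ₀]
  exact TopC_eq_DopC hUσ hr hsubσ
    (sepHolOn_DopC_inner_poly hΨσ lD.toFinset (fun j _ => h0 j) (fun j _ => h1 j) hτ₀) lZ hlZ σ₀ hσ₀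

/-- **The iterated Cauchy estimate for the generic term (2.14), per-domain τ-regions**: `Ψ` separately holomorphic in the
`σ` on an open `Uσ ⊇ {|z| ≤ Rσ_j}` for every admissible `τ`, and of the poly class in the `τ` on open `Uτ Y ⊇ {|z| ≤ Rτ_Y}`
for every admissible `σ`, all containing the closed `r`-discs about `[0, 1]`; radii `> 1` on the lists; a sup bound
`‖Ψ σ τ‖ ≤ K` on the product of the two closed polydiscs.  Then at base points of the polydiscs
`‖term214 r lZ lD Ψ σ₀ τ₀‖ ≤ K · Π_{Δ∈lZ} (Rσ_Δ − 1)⁻¹ · Π_{Y∈lD} (Rτ_Y − 1)⁻¹` (`B13CauchyDecay.norm_term214_le`, poly in τ: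
the inner τ-operator by `TopC_eq_DopC_poly` + `norm_DopC_le_poly`, the outer σ-operator by the tree's `norm_TopC_le`).
[cite: Balaban1988RG2Cluster, (2.14) p.15, (2.26) p.17] -/
theorem norm_term214_le_polyτ [CompleteSpace E] {κ : Type*} [DecidableEq κ] {Uσ : Set ℂ} {Uτ : κ → Set ℂ}
    (hUσ : IsOpen Uσ) (hUτ : ∀ Y, IsOpen (Uτ Y)) {r : ℝ} (hr : 0 < r)
    (hsubσ : ∀ s ∈ Set.uIcc (0 : ℝ) 1, closedBall (s : ℂ) r ⊆ Uσ)
    (hsubτ : ∀ Y, ∀ s ∈ Set.uIcc (0 : ℝ) 1, closedBall (s : ℂ) r ⊆ Uτ Y) {Ψ : (ι → ℂ) → (κ → ℂ) → E}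
    (hΨσ : ∀ τ : κ → ℂ, (∀ j, τ j ∈ Uτ j) → SepHolOn Uσ (fun σ => Ψ σ τ))
    (hΨτ : ∀ σ : ι → ℂ, (∀ j, σ j ∈ Uσ) → SepHolOnPoly Uτ (fun τ => Ψ σ τ))
    {Rσ : ι → ℝ} {Rτ : κ → ℝ} (hRσU : ∀ j, closedBall (0 : ℂ) (Rσ j) ⊆ Uσ)
    (hRτU : ∀ j, closedBall (0 : ℂ) (Rτ j) ⊆ Uτ j) {K : ℝ}
    (hK : ∀ (σ : ι → ℂ) (τ : κ → ℂ), (∀ j, ‖σ j‖ ≤ Rσ j) → (∀ j, ‖τ j‖ ≤ Rτ j) → ‖Ψ σ τ‖ ≤ K)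
    {lZ : List ι} (hlZ : lZ.Nodup) (hRσ1 : ∀ i ∈ lZ, 1 < Rσ i) {lD : List κ} (hlD : lD.Nodup)
    (hRτ1 : ∀ i ∈ lD, 1 < Rτ i) {σ₀ : ι → ℂ} (hσ₀ : ∀ j, ‖σ₀ j‖ ≤ Rσ j) {τ₀ : κ → ℂ}
    (hτ₀ : ∀ j, ‖τ₀ j‖ ≤ Rτ j) :
    ‖term214 r lZ lD Ψ σ₀ τ₀‖ ≤
      K * (∏ i ∈ lZ.toFinset, (Rσ i - 1)⁻¹) * ∏ i ∈ lD.toFinset, (Rτ i - 1)⁻¹ := by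
  have h0τ : ∀ Y, (0 : ℂ) ∈ Uτ Y := fun Y => by
    simpa using hsubτ Y 0 (by simp) (mem_closedBall_self hr.le)
  have h1τ : ∀ Y, (1 : ℂ) ∈ Uτ Y := fun Y => by
    simpa using hsubτ Y 1 (by simp) (mem_closedBall_self hr.le)
  have hτ₀U : ∀ j, τ₀ j ∈ Uτ j := fun j => hRτU j (mem_closedBall_zero_iff.2 (hτ₀ j))
  have hσ₀U : ∀ j, σ₀ j ∈ Uσ := fun j => hRσU j (mem_closedBall_zero_iff.2 (hσ₀ j))
  -- inner operator: Cauchy form = difference form at every admissible `σ`, and its bound on the σ-polydisc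
  have hinner : ∀ σ : ι → ℂ, (∀ j, σ j ∈ Uσ) →
      TopC r lD (fun τ => Ψ σ τ) τ₀ = DopC lD.toFinset (fun τ => Ψ σ τ) τ₀ :=
    fun σ hσ => TopC_eq_DopC_poly hUτ hr hsubτ (hΨτ σ hσ) lD hlD τ₀ hτ₀U
  have hinner_bd : ∀ σ : ι → ℂ, (∀ j, ‖σ j‖ ≤ Rσ j) →
      ‖DopC lD.toFinset (fun τ => Ψ σ τ) τ₀‖ ≤ K * ∏ i ∈ lD.toFinset, (Rτ i - 1)⁻¹ := by
    intro σ hσ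
    have hσU : ∀ j, σ j ∈ Uσ := fun j => hRσU j (mem_closedBall_zero_iff.2 (hσ j))
    exact norm_DopC_le_poly hUτ (hΨτ σ hσU) hRτU (fun τ hτ => hK σ τ hσ hτ) lD.toFinset
      (fun i hi => hRτ1 i (List.mem_toFinset.1 hi)) τ₀ hτ₀
  unfold term214
  rw [TopC_congr hr hsubσ hinner lZ σ₀ hσ₀U]
  -- outer operator on the (separately holomorphic, bounded) inner difference form
  have hΦ : SepHolOn Uσ (fun σ => DopC lD.toFinset (fun τ => Ψ σ τ) τ₀) :=
    sepHolOn_DopC_inner_poly hΨσ lD.toFinset (fun j _ => h0τ j) (fun j _ => h1τ j) hτ₀U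
  have h := norm_TopC_le hUσ hr hsubσ hΦ hRσU hinner_bd hlZ hRσ1 hσ₀
  simpa [mul_comm, mul_left_comm, mul_assoc] using h

end Poly

/-! ## §C. (2.15)'s Cauchy part at the printed σ-radius and per-domain τ-regions -/

section FirstEstimate

variable {F : Type*} [NormedAddCommGroup F] [NormedSpace ℂ F] [CompleteSpace F]
variable {ι : Type*} [DecidableEq ι]

/-- **(2.15), its Cauchy part, per-domain τ-regions** (p. 15, the «first estimate»; the per-domain radii of (2.18) p. 16):
for the generic term (2.14) `term214 r lZ lD Ψ σ₀ τ₀` with `Ψ` separately holomorphic in `σ` on an open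
`Uσ ⊇ {|σ| ≤ e^{κ₁}}` (`κ₁ ≥ 1`) and of the poly class in `τ` on open `Uτ Y ⊇ {|τ| ≤ R_τ(Y)}`, `R_τ(Y) ≥ 2`, and
`‖Ψ σ τ‖ ≤ K` on the two closed polydiscs: `‖(2.14)‖ ≤ exp(−(κ₁ − 1)|lZ|) · [Π_{Y∈𝐃} 2/R_τ(Y)] · K`
(`B13CauchyDecay.norm_term214_le_215`, poly in τ). [cite: Balaban1988RG2Cluster, (2.14)–(2.15) p.15, (2.18) p.16, (2.26) p.17] -/
theorem norm_term214_le_215_polyτ {κ : Type*} [DecidableEq κ] {κ₁ : ℝ} (hκ₁ : 1 ≤ κ₁) (Rτ : κ → ℝ)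
    (hR2 : ∀ Y, 2 ≤ Rτ Y) {Uσ : Set ℂ} {Uτ : κ → Set ℂ} (hUσ : IsOpen Uσ) (hUτ : ∀ Y, IsOpen (Uτ Y))
    (hUexp : closedBall (0 : ℂ) (Real.exp κ₁) ⊆ Uσ) (hUtau : ∀ Y, closedBall (0 : ℂ) (Rτ Y) ⊆ Uτ Y)
    {r : ℝ} (hr : 0 < r) (hr' : r ≤ Real.exp κ₁ - 1)
    (hsubτ : ∀ Y, ∀ s ∈ Set.uIcc (0 : ℝ) 1, closedBall (s : ℂ) r ⊆ Uτ Y) {Ψ : (ι → ℂ) → (κ → ℂ) → F}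
    (hΨσ : ∀ τ : κ → ℂ, (∀ j, τ j ∈ Uτ j) → SepHolOn Uσ (fun σ => Ψ σ τ))
    (hΨτ : ∀ σ : ι → ℂ, (∀ j, σ j ∈ Uσ) → SepHolOnPoly Uτ (fun τ => Ψ σ τ)) {K : ℝ}
    (hK : ∀ (σ : ι → ℂ) (τ : κ → ℂ), (∀ j, ‖σ j‖ ≤ Real.exp κ₁) → (∀ Y, ‖τ Y‖ ≤ Rτ Y) → ‖Ψ σ τ‖ ≤ K)
    {lZ : List ι} (hlZ : lZ.Nodup) {lD : List κ} (hlD : lD.Nodup)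
    {σ₀ : ι → ℂ} (hσ₀ : ∀ j, ‖σ₀ j‖ ≤ 1) {τ₀ : κ → ℂ} (hτ₀ : ∀ Y, ‖τ₀ Y‖ ≤ 1) :
    ‖term214 r lZ lD Ψ σ₀ τ₀‖ ≤
      Real.exp (-(κ₁ - 1) * lZ.length) * (∏ Y ∈ lD.toFinset, 2 * (Rτ Y)⁻¹) * K := by
  have hexp1 : (1 : ℝ) < Real.exp κ₁ := by
    have := Real.add_one_le_exp κ₁; linarith
  have hsubσ : ∀ s ∈ Set.uIcc (0 : ℝ) 1, closedBall (s : ℂ) r ⊆ Uσ :=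
    fun s hs => (closedBall_subset_closedBall_of_mem_uIcc hr' hs).trans hUexp
  have hmain := norm_term214_le_polyτ hUσ hUτ hr hsubσ hsubτ hΨσ hΨτ (Rσ := fun _ => Real.exp κ₁)
    (Rτ := Rτ) (fun _ => hUexp) hUtau (K := K) hK hlZ (fun _ _ => hexp1) hlD
    (fun Y _ => by linarith [hR2 Y]) (σ₀ := σ₀) (fun j => (hσ₀ j).trans hexp1.le) (τ₀ := τ₀)
    (fun Y => (hτ₀ Y).trans (by linarith [hR2 Y]))
  have hK0 : 0 ≤ K := (norm_nonneg _).trans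
    (hK (fun _ => 0) (fun _ => 0) (fun _ => by simp only [norm_zero]; positivity)
      (fun Y => by simp only [norm_zero]; linarith [hR2 Y]))
  rw [Finset.prod_const, List.toFinset_card_of_nodup hlZ] at hmain
  have hA : ((Real.exp κ₁ - 1)⁻¹) ^ lZ.length ≤ Real.exp (-(κ₁ - 1) * lZ.length) :=
    pow_inv_exp_sub_one_le hκ₁ _
  have hB : ∏ Y ∈ lD.toFinset, (Rτ Y - 1)⁻¹ ≤ ∏ Y ∈ lD.toFinset, 2 * (Rτ Y)⁻¹ :=
    Finset.prod_le_prod (fun Y _ => inv_nonneg.2 (by linarith [hR2 Y]))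
      fun Y _ => inv_sub_one_le_two_mul_inv (hR2 Y)
  have hB0 : 0 ≤ ∏ Y ∈ lD.toFinset, (Rτ Y - 1)⁻¹ :=
    Finset.prod_nonneg fun Y _ => inv_nonneg.2 (by linarith [hR2 Y])
  calc ‖term214 r lZ lD Ψ σ₀ τ₀‖
      ≤ K * ((Real.exp κ₁ - 1)⁻¹) ^ lZ.length * ∏ Y ∈ lD.toFinset, (Rτ Y - 1)⁻¹ := hmain
    _ ≤ K * Real.exp (-(κ₁ - 1) * lZ.length) * ∏ Y ∈ lD.toFinset, 2 * (Rτ Y)⁻¹ := by gcongr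
    _ = Real.exp (-(κ₁ - 1) * lZ.length) * (∏ Y ∈ lD.toFinset, 2 * (Rτ Y)⁻¹) * K := by ring

end FirstEstimate

end Literature.MathematicalPhysics.QuantumFieldTheory.Balaban1983to89.B13CauchyDecayPoly

end
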